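import Literature.MathematicalPhysics.QuantumFieldTheory.Balaban1983to89.B11Eq117MiddleWordPiTransformationNorm
import Literature.MathematicalPhysics.QuantumFieldTheory.Balaban1983to89.B11Eq117GtildeTransformationNorm
import Literature.MathematicalPhysics.QuantumFieldTheory.Balaban1983to89.B9Eq3119DeltaPiTowerFlat

/-!
# `Balaban1983to89.B11Eq117TwoWordsTransformationNormFlat` — T. Bałaban, *The variational problem and background fields in renormalization group method for
# lattice gauge theories*, Commun. Math. Phys. **102** (1985) 277–309 [Balaban1985Variational] (117) p. 295, (110)–(111) p. 294, with [Balaban1985BackgroundPropagators]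
# Thm 3.13 p. 426, (3.130) p. 421, (3.122) p. 420 and p. 395 *«It coincides with Δ_a in (2.19) [4] if U = 1»*: **THE (117) SOCKETS FOR THE FIRST TWO WORDS OF `𝔊̃_k`
# AT THE FLAT BACKGROUND `U ≡ 1` — THE ≈ 50-BINDER MODEL BLOCK OF THE `G̃_k` LETTER FILES IS INHABITED AT EVERY HEIGHT, AND THE TWO TRANSFORMATION-NORM BOUNDS
# HOLD THERE WITH NO MODEL LETTER DISPLAYED** — a NON-VACUITY certificate for the common binder block of (T4B)∕(T4C)∕(T4F) (t4-ne9-p1 g97), (K77)∕(K80)–(K86)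
# (ne9-leaf-05 g88) and (J-1)–(J-4) (this lineage, gen 91): at `U := 1`, `α_j := 0`, `ε_j := 0`, `α := 0`, `j₀ := 0` every window ∕ regularity ∕ profile ∕ unitary
# letter holds (the flat tower data of ne9-leaf-02's `B9Eq315QTowerFlat`, `plaqHolU_one`, `adTransportW_one`, the current `J(1) = 0`), the four positivity ∕
# right-inverse witnesses are INHABITED BY NAME (`laplacePrimeAk_one_pos`, `laplaceAk_one_pos₀`, `laplaceAkPi_one_pos_iff` (§1 `hposπ_one`), `QkW_one_surjective`), and the sockets
# (T4F) `exists_norm_toCLM115_G1kPi_le` ∕ (J-4) `exists_norm_toCLM115_H1kPiQkG1kPi_le` are APPLIED there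

statement-level skeleton of published theorems with citation tags; proofs where landed; nothing here is a claim about the Yang–Mills mass gap

CITATION HEADER (lean-in-tree rule).  Audit cell `pub-balaban`, sub-cell `t4`, BINDER row NE9; NE9 crux-team LEAF PROVER 01 (`b2b-balaban-t4-ne9-formalise-leaf-01`, gen 91;
(J-5); bears_on: R4/N22).  Composed BY NAME, nothing restated: (T4F), (J-4); ne9-leaf-02's `B9Eq315QTowerFlat.UlevOf_one` ∕ `perCfg_UlevOf_one_mem_U1` ∕
`norm_Wcx_UlevOf_one_sub_one_le`; the owner's `B9Eq326OperatorTowerFlat.laplaceAk_one_pos₀` and `B9Eq324DeltaPrimeATower.laplacePrimeAk_one_pos`; ne9-leaf-03's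
`B9Eq3119DeltaPiTowerFlat.laplaceAkPi_one_pos_iff`; `B9Eq326OperatorTower.QkW_surjective`; `B5Eq172HodgePositivity.adTransportW_one`; `B9Eq310DeltaPrime.plaqHolU_one`;
`B9Eq37Insertion.imC_one`, `B9Eq39Adjoint.covDstar_zero` (the current at the flat background).  Sources read through the audited headers of (T4F), (J-4) and the flat
files ([Balaban1985Variational] p. 294 (115), p. 295 (117), `paper:balaban1985-cmp102-variational-background`, journal page = PDF page + 276; [Balaban1985BackgroundPropagators]
pp. 395, 420–421, 426, `paper:balaban1985-cmp99-background-propagators`, journal page = PDF page + 388).  NOTHING of print's proof is reproduced; no constant of print is valued.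

WHAT IS PROVED (sorry-free; proof lane — no `def`; [folklore] bookkeeping).
* §1 `norm_J_one_le` — the current letter at the flat background, `‖J(1)(μ, y)‖ ≤ 0` (new); `hposπ_one` — the `hposπ` witness at `U ≡ 1` (ne9-leaf-03's
  `laplaceAkPi_one_pos_iff` ∘ the owner's `laplaceAk_one_pos₀`).  The other three Prop-valued witnesses are tree names ALREADY and are not restated (dedup):
  `hpos′` = `B9Eq324DeltaPrimeATower.laplacePrimeAk_one_pos`, `hpos` = `B9Eq326OperatorTowerFlat.laplaceAk_one_pos₀`, `hQ` = `B9Eq315QTowerFlat.QkW_one_surjective`;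
  `hU1`∕`hreg` = ne9-leaf-02's `perCfg_UlevOf_one_mem_U1` ∕ `norm_Wcx_UlevOf_one_sub_one_le`.
* §2 **`exists_norm_toCLM115_G1kPi_one_le`** — `∃ B ≥ 0, ∀ n η (ηL^{n+1} = 1) c₀ c₁ (c₀(L^{n+1})^d = c₁) (|η|^d∕c₀ ≤ ρ_w) m U (hU : U = 1) αU (hαU : αU = 0)`,
  ∀ the SUBSINGLETON binders `hα1 hU1 hreg hpos′ hpos hposπ` (Prop-valued; inhabited at `U = 1`, `α_j = 0` by §1 and ne9-leaf-02's flat tower data), `(hc₀ : c₀ = η^d)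
  (Lw ηw lev₀ lev₁)`: `‖toCLM115 … (∇_U) (G̃_k(U) read on plain bond functions)‖ ≤ max(w̄₀·B, w̄₁·B)·w̲⁻¹`; **`exists_norm_toCLM115_H1kPiQkG1kPi_one_le`** — the same
  for the second word `H̃_kQ_kG̃_k` (extra subsingletons `hαL`, `hQ`).  The thirteen NUMERIC model letters of the block (`ε_j`-profile ×2, level unitarity, the window
  `α ≤ α₁`, `U† = U⁻¹`, `U ∈ U1`, `‖U − 1‖ ≤ αη`, `‖U(∂p) − 1‖ ≤ αη²`, `‖U(x,μ) − U(x−e_μ,μ)‖ ≤ αη²`, `‖R(Ū^j)‖ ≤ 1`, `ε_j ≤ αϱ^j`,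
  `Σα_j ≤ A_Q`, `‖J‖ ≤ j₀`) are DISCHARGED inside the proof at `α_j = ε_j = α = j₀ = 0`.  TYPING NOTE: the equations `hU`, `hαU` (instead of the literals
  `U := 1`, `α_j := 0` with tactic proofs of `hα1` in the binder types) keep the statement free of delayed tactic metavariables — with the literals the two
  occurrences of `laplaceAk … (fun _ => by norm_num) …` made the unifier exhaust any heartbeat budget at the `toCLM115` line.
HONEST SCOPE.  A non-vacuity ∕ consistency certificate for the hypothesis block of the `G̃_k` letter files and the flat instance of two socket bounds; the
constants `B` are the files' symbolic ones; `0 ≤ A_Q` is assumed (the block's `Σα_j ≤ A_Q`); the structure data of the fibre (`φ, τ, M_φ, M_φ′, C_τ, M_τ`, `hφτ`, …)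
stay section hypotheses as in every file of the road.  Nothing of [B11] (117) or [B9] Thm 3.13 is asserted, valued or discharged beyond the named files at `U ≡ 1`;
«NE9 ⇐ the named binders»; NE9 NOT PRINTED ∕ NOT PROVED; row WALLED ON A MODEL (O-NE9-1; #5 UNRULED); spine PROVED 0∕9; rung (B)+1 on a finite T⁴ — NOT infinite
volume, NOT mass gap, NOT BetaPertH, NOT Clay.  HONEST DEPENDENCY: continuum YM on T⁴ ⇐ BetaPertH ∧ nine spine estimates (0/9 proved); BetaPertH ⇐ (D1) ∧ (D4) ∧
CAP+tail; G-an2-4 gates asym, D1 and NE2/3/4.  NEW file importing (J-4), (T4F), `B9Eq3119DeltaPiTowerFlat`; nothing modified.  Net new unproved facts: 0.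
-/

noncomputable section

set_option autoImplicit false

open scoped InnerProductSpace ComplexConjugate BigOperators

namespace Literature.MathematicalPhysics.QuantumFieldTheory.Balaban1983to89.B11Eq117TwoWordsTransformationNormFlat

open B4Sect5Torus (TSite)
open B9SectCLatticeCarrier (Bond bpos btgt unshift)
open B9Eq311L2Pairing (WL2)
open B9Eq33CovDerivVector (covGrad)
open B7Prop1Explicit (U1 Wcx boxVec)
open B11Eq103H1Complex (SiteL2K BondL2K covDerivL2K covDivL2K G1LatticeK H1LatticeK)
open B9Eq310DeltaPrime (plaqHolU plaqHolU_one)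
open B9Eq310HessianOperator (adTransportW)
open B9Eq315QTorus (perCfg cornerSite)
open B9Eq315QTower (towerP UlevOf)
open B9Eq315QTowerFlat (UlevOf_one perCfg_UlevOf_one_mem_U1 norm_Wcx_UlevOf_one_sub_one_le)
open B9Eq326OperatorTower (laplaceAk QkW QkW_surjective)
open B9Eq326OperatorTowerFlat (laplaceAk_one_pos₀)
open B9Eq324DeltaPrimeATower (laplacePrimeAk laplacePrimeAk_one_pos)
open B9Eq3119DeltaPiTower (laplaceAkPi)
open B9Eq3119DeltaPiTowerFlat (laplaceAkPi_one_pos_iff)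
open B5Eq172HodgePositivity (adTransportW_one)
open B9Eq37Insertion (imC imC_one)
open B11Eq115Space (NegSup levWeight)
open B11Eq111FrakG (toCLM115)
open B11Eq117GtildeTransformationNorm (exists_norm_toCLM115_G1kPi_le)
open B11Eq117MiddleWordPiTransformationNorm (exists_norm_toCLM115_H1kPiQkG1kPi_le)

/-! ## §1 The flat inhabitants -/

section Flat

variable {d : ℕ} (L : ℕ) [NeZero L] (m : Fin d → ℕ) [∀ i, NeZero (m i)] (n : ℕ) (hL : 1 ≤ L)
  {𝔸 : Type*} [NormedRing 𝔸] [NormedAlgebra ℂ 𝔸] [CompleteSpace 𝔸] [NormOneClass 𝔸] [StarRing 𝔸] [NormedStarGroup 𝔸] [StarModule ℂ 𝔸]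
  {W : Type*} [NormedAddCommGroup W] [InnerProductSpace ℂ W] [FiniteDimensional ℂ W] (φ : W ≃ₗ[ℂ] 𝔸)
  {c₀ c₁ : ℝ} [Fact (0 < c₀)] [Fact (0 < c₁)] {η : ℝ} (hη : η ≠ 0) (τ : 𝔸 →ₗ[ℂ] ℂ) {a : ℝ} (ha : 0 < a) {a' : ℝ} (ha' : 0 < a')

omit [NeZero L] [∀ i, NeZero (m i)] [CompleteSpace 𝔸] [NormOneClass 𝔸] [StarRing 𝔸] [NormedStarGroup 𝔸] [StarModule ℂ 𝔸] in
/-- **The current vanishes at the flat background**: `‖J(1)(μ, y)‖ ≤ 0` — every plaquette variable of `U ≡ 1` is `1`, `Im 1 = 0`, and the covariant divergence of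
the zero plaquette function is zero. [folklore] [cite: Balaban1985BackgroundPropagators, (3.11) p.392, (3.117) p.419] -/
theorem norm_J_one_le {Pd : Fin d → ℕ} [∀ i, NeZero (Pd i)] (η' : ℝ) (μ : Fin d) (y : TSite d Pd) :
    ‖B9Eq39Adjoint.J (fun μ => B9Eq33CovDerivVector.shiftEquiv μ) (fun (μ : Fin d) (y : TSite d Pd) => ((fun _ : Bond d Pd => (1 : 𝔸ˣ)) (y, μ))) η' μ y‖ ≤ 0 := by
  have hF : (fun (μ ν : Fin d) (x : TSite d Pd) => (((η' : ℂ)⁻¹) ^ 2) •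
      imC (B9Eq39Adjoint.plaqU (fun μ => B9Eq33CovDerivVector.shiftEquiv μ) (fun (μ : Fin d) (y : TSite d Pd) => ((fun _ : Bond d Pd => (1 : 𝔸ˣ)) (y, μ))) μ ν x)) =
      fun _ _ => (0 : TSite d Pd → 𝔸) := by
    funext μ ν x
    simp only [B9Eq39Adjoint.plaqU, mul_one, inv_one, imC_one, smul_zero, Pi.zero_apply]
  have h0 : B9Eq39Adjoint.J (fun μ => B9Eq33CovDerivVector.shiftEquiv μ) (fun (μ : Fin d) (y : TSite d Pd) => ((fun _ : Bond d Pd => (1 : 𝔸ˣ)) (y, μ))) η' μ y = 0 := by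
    rw [B9Eq39Adjoint.J, hF, B9Eq39Adjoint.divPη, B9Eq39Adjoint.divP]
    simp only [B9Eq39Adjoint.covDstar_zero, ite_self, Finset.sum_const_zero, sub_self, smul_zero]
  rw [h0, norm_zero]

omit [NormedStarGroup 𝔸] in
include hη ha in
/-- `hposπ` at the flat background: print's `Δ̃_{a,k}(1)` IS the chain's `Δ_{a,k}(1)` (ne9-leaf-03's `laplaceAkPi_one_pos_iff`), so the owner's `laplaceAk_one_pos₀` transfers.
[cite: Balaban1985BackgroundPropagators, (3.122) p.420, Thm 3.11 p.416] -/
theorem hposπ_one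
    (hpos' : ∀ x : SiteL2K ℂ d (towerP L m (n + 1)) c₀ W, x ≠ 0 →
      0 < RCLike.re ⟪x, laplacePrimeAk L m n φ η (fun _ : Bond d (towerP L m (n + 1)) => (1 : 𝔸ˣ)) a' (c₁ := c₁) x⟫_ℂ) :
    ∀ x : BondL2K ℂ d (towerP L m (n + 1)) c₀ W, x ≠ 0 →
      0 < RCLike.re ⟪x, laplaceAkPi L m n φ τ η (fun _ : Bond d (towerP L m (n + 1)) => (1 : 𝔸ˣ)) a' hpos' hL (fun _ => 0) (fun _ => by norm_num)
        (perCfg_UlevOf_one_mem_U1 L m (n + 1)) (norm_Wcx_UlevOf_one_sub_one_le L m (n + 1) (fun _ => 0) (fun _ => le_rfl)) (c₁ := c₁) a x⟫_ℂ :=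
  (laplaceAkPi_one_pos_iff L m n φ τ η a' hpos' hL (fun _ => 0) (fun _ => by norm_num) (perCfg_UlevOf_one_mem_U1 L m (n + 1))
    (norm_Wcx_UlevOf_one_sub_one_le L m (n + 1) (fun _ => 0) (fun _ => le_rfl)) a).2
    (fun x hx => laplaceAk_one_pos₀ L m n hL φ (c₀ := c₀) (c₁ := c₁) hη τ ha x hx)

end Flat

/-! ## §2 The two sockets at `U ≡ 1` -/

variable {d : ℕ} (hd : 1 ≤ d) (L : ℕ) [NeZero L] (hL : 1 ≤ L) (hL3 : 3 ≤ L)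
  {𝔸 : Type*} [NormedRing 𝔸] [NormedAlgebra ℂ 𝔸] [CompleteSpace 𝔸] [NormOneClass 𝔸] [StarRing 𝔸] [NormedStarGroup 𝔸] [StarModule ℂ 𝔸]
  {W : Type*} [NormedAddCommGroup W] [InnerProductSpace ℂ W] [FiniteDimensional ℂ W] (φ : W ≃ₗ[ℂ] 𝔸)
  {Mφ Mφ' : ℝ} (hMφ : 0 ≤ Mφ) (hMφ' : 0 ≤ Mφ') (hφ : ∀ w, ‖φ w‖ ≤ Mφ * ‖w‖) (hφ' : ∀ X, ‖φ.symm X‖ ≤ Mφ' * ‖X‖) (hstar : ∀ X : 𝔸, ‖star X‖ ≤ ‖X‖)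
  {a : ℝ} (ha : 0 < a) {a' : ℝ} (ha' : 0 < a') {ϱ : ℝ} (hϱ0 : 0 ≤ ϱ) (hϱ1 : ϱ < 1)
  (τ : 𝔸 →ₗ[ℂ] ℂ) {Cτ : ℝ} (hτ : ∀ X, ‖τ X‖ ≤ Cτ * ‖X‖) (hCτ : 0 ≤ Cτ) {Mτ : ℝ} (hτm : ∀ X Y : 𝔸, ‖τ (X * Y)‖ ≤ Mτ * ‖X‖ * ‖Y‖) (hMτ : 0 ≤ Mτ)
  {ρw : ℝ} (hρw : 0 ≤ ρw)
  (hτ₁ : ∀ X : 𝔸, τ (star X) = conj (τ X)) (hτ₂ : ∀ X Y : 𝔸, τ (X * Y) = τ (Y * X)) (hφτ : ∀ X Y : 𝔸, ⟪φ.symm X, φ.symm Y⟫_ℂ = τ (star X * Y))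
  {AQ : ℝ} (hAQ : 0 ≤ AQ)

omit [NeZero L] in
include hL in
/-- `0 < η` from `ηL^{n+1} = 1`, `1 ≤ L`. [folklore] -/
private theorem eta_pos {n : ℕ} {η : ℝ} (hηL : η * (L : ℝ) ^ (n + 1) = 1) : 0 < η := by
  have hLp : (0 : ℝ) < (L : ℝ) ^ (n + 1) := pow_pos (Nat.cast_pos.2 hL) _
  by_contra h
  have : η * (L : ℝ) ^ (n + 1) ≤ 0 := mul_nonpos_of_nonpos_of_nonneg (not_lt.mp h) hLp.le
  linarith only [this, hηL]

set_option maxHeartbeats 400000 in -- margin only, as (T4F): the ≈ 50-binder supplier instantiated at the flat data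
include hd hL hL3 hMφ hMφ' hφ hφ' hstar ha ha' hϱ0 hϱ1 hτ hCτ hτm hMτ hρw hτ₁ hτ₂ hφτ hAQ in
/-- **THE (117) SOCKET FOR THE FIRST WORD `G̃_k` AT THE FLAT BACKGROUND** — (T4F) `exists_norm_toCLM115_G1kPi_le` applied at `U = 1`, `α_j = 0` (pinned by the
equations `hU`, `hαU`) with `ε_j = α = 0`: the thirteen numeric MODEL letters of its block discharged (`UlevOf_one`, `plaqHolU_one`, `adTransportW_one`, `norm_J_one_le`),
only the data relations and the subsingleton binders `hα1 hU1 hreg hpos′ hpos hposπ` (inhabited, §1) remain. [cite: Balaban1985Variational, (117) p.295, (115) p.294;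
Balaban1985BackgroundPropagators, Thm 3.13 p.426, (3.130) p.421, p.395] -/
theorem exists_norm_toCLM115_G1kPi_one_le :
    ∃ B : ℝ, 0 ≤ B ∧
      ∀ (n : ℕ) (η : ℝ) (_hηL : η * (L : ℝ) ^ (n + 1) = 1) (c₀ c₁ : ℝ) [Fact (0 < c₀)] [Fact (0 < c₁)]
        (_hw : c₀ * ((L : ℝ) ^ (n + 1)) ^ d = c₁) (_hρ : |η| ^ d / c₀ ≤ ρw) (m : Fin d → ℕ) [∀ i, NeZero (m i)] (_hm : ∀ i, 1 ≤ m i)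
        (U : Bond d (towerP L m (n + 1)) → 𝔸ˣ) (_hU : U = fun _ => 1) (αU : ℕ → ℝ) (_hαU : αU = fun _ => 0) (hα1 : ∀ j, αU j ≤ 1 / 64)
        (hU1 : ∀ (j : ℕ) (x : B7Prop1Explicit.Site d) (k : Fin d), perCfg (towerP L m (j + 1)) (UlevOf L m (n + 1) U j) x k ∈ U1 𝔸)
        (hreg : ∀ (j : ℕ) (y : TSite d (towerP L m j)) (k : Fin d) (ρ' : Fin d → Fin L),
          ‖((Wcx L (perCfg (towerP L m (j + 1)) (UlevOf L m (n + 1) U j)) (cornerSite L y) k (boxVec L ρ') : 𝔸ˣ) : 𝔸) - 1‖ ≤ αU j)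
        (hpos' : ∀ x : SiteL2K ℂ d (towerP L m (n + 1)) c₀ W, x ≠ 0 → 0 < RCLike.re ⟪x, laplacePrimeAk L m n φ η U a' (c₁ := c₁) x⟫_ℂ)
        (_hpos : ∀ x : BondL2K ℂ d (towerP L m (n + 1)) c₀ W, x ≠ 0 →
          0 < RCLike.re ⟪x, laplaceAk L m n φ η U hL αU hα1 hU1 hreg τ (c₀ := c₀) (c₁ := c₁) a x⟫_ℂ)
        (hposπ : ∀ x : BondL2K ℂ d (towerP L m (n + 1)) c₀ W, x ≠ 0 →
          0 < RCLike.re ⟪x, laplaceAkPi L m n φ τ η U a' hpos' hL αU hα1 hU1 hreg (c₁ := c₁) a x⟫_ℂ)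
        (_hc₀ : c₀ = η ^ d)
        (Lw ηw : ℝ) [Fact (0 < Lw)] [Fact (0 < ηw)] (lev₀ : Bond d (towerP L m (n + 1)) → ℕ) (lev₁ : Bond d (towerP L m (n + 1)) × Fin d → ℕ),
        ‖toCLM115 (L := Lw) (η := ηw) (lev₀ := lev₀) lev₁ (covGrad ((η : ℂ))⁻¹ (adTransportW φ U))
            ((WL2.linearEquiv ℂ ℂ (fun _ : Bond d (towerP L m (n + 1)) => c₀)).toLinearMap ∘ₗ (G1LatticeK hposπ : _ →ₗ[ℂ] _) ∘ₗ
              ((WL2.linearEquiv ℂ ℂ (fun _ : Bond d (towerP L m (n + 1)) => c₀)).symm.toLinearMap :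
                (Bond d (towerP L m (n + 1)) → W) →ₗ[ℂ] BondL2K ℂ d (towerP L m (n + 1)) c₀ W))‖ ≤
          max ((NegSup.wSup (levWeight Lw ηw lev₀ 1) : ℝ) * B) (NegSup.wSup (levWeight Lw ηw lev₁ 2) * B) *
            NegSup.wInvSup (levWeight Lw ηw lev₀ 3) := by
  classical
  obtain ⟨α₁, B, hα₁, hB, H⟩ := exists_norm_toCLM115_G1kPi_le hd L hL hL3 φ hMφ hMφ' hφ hφ' hstar ha ha' hϱ0 hϱ1 τ hτ hCτ hτm hMτ hρw hτ₁ hτ₂ hφτ AQ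
  refine ⟨B, hB, ?_⟩
  intro n η hηL c₀ c₁ _ _ hw hρ m _ hm U hU αU hαU hα1 hU1 hreg hpos' hpos hposπ hc₀ Lw ηw _ _ lev₀ lev₁
  subst hU hαU
  have hη : 0 < η := eta_pos L hL hηL
  have hUε1 : ∀ (j : ℕ) (b : Bond d (towerP L m (j + 1))), ‖(UlevOf L m (n + 1) (fun _ : Bond d (towerP L m (n + 1)) => (1 : 𝔸ˣ)) j b : 𝔸) - 1‖ ≤ (fun _ : ℕ => (0 : ℝ)) j := by
    intro j b; rw [UlevOf_one]; simp
  have hLb1 : ∀ (j : ℕ) (b : Bond d (towerP L m (j + 1))), UlevOf L m (n + 1) (fun _ : Bond d (towerP L m (n + 1)) => (1 : 𝔸ˣ)) j b ∈ U1 𝔸 := by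
    intro j b; rw [UlevOf_one]; exact Subgroup.one_mem _
  have hUst1 : ∀ b : Bond d (towerP L m (n + 1)), star ((fun _ : Bond d (towerP L m (n + 1)) => (1 : 𝔸ˣ)) b : 𝔸) =
      ((((fun _ : Bond d (towerP L m (n + 1)) => (1 : 𝔸ˣ)) b)⁻¹ : 𝔸ˣ) : 𝔸) := fun b => by simp
  have hUb1 : ∀ b : Bond d (towerP L m (n + 1)), (fun _ : Bond d (towerP L m (n + 1)) => (1 : 𝔸ˣ)) b ∈ U1 𝔸 := fun b => Subgroup.one_mem _
  have hUη1 : ∀ b : Bond d (towerP L m (n + 1)), ‖((fun _ : Bond d (towerP L m (n + 1)) => (1 : 𝔸ˣ)) b : 𝔸) - 1‖ ≤ 0 * η := fun b => by simp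
  have hpl1 : ∀ p : B9SectCLatticeCarrier.Plaq d (towerP L m (n + 1)), ‖(plaqHolU (fun _ : Bond d (towerP L m (n + 1)) => (1 : 𝔸ˣ)) p : 𝔸) - 1‖ ≤ 0 * η ^ 2 :=
    fun p => by rw [plaqHolU_one]; simp
  have hUgrad1 : ∀ (x : TSite d (towerP L m (n + 1))) (μ : Fin d), ‖((fun _ : Bond d (towerP L m (n + 1)) => (1 : 𝔸ˣ)) (x, μ) : 𝔸) -
      (fun _ : Bond d (towerP L m (n + 1)) => (1 : 𝔸ˣ)) (unshift μ x, μ)‖ ≤ 0 * η ^ 2 := fun x μ => by simp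
  have hRlev1 : ∀ (j : ℕ) (b : Bond d (towerP L m (j + 1))) (w : W), ‖adTransportW φ (UlevOf L m (n + 1) (fun _ : Bond d (towerP L m (n + 1)) => (1 : 𝔸ˣ)) j) b w‖ ≤ ‖w‖ := by
    intro j b w; rw [UlevOf_one, adTransportW_one]; simp
  have hεg1 : ∀ j < n + 1, (fun _ : ℕ => (0 : ℝ)) j ≤ 0 * ϱ ^ j := fun j _ => by simp
  have hAQ1 : ∑ j ∈ Finset.range (n + 1), (fun _ : ℕ => (0 : ℝ)) j ≤ AQ := by simp [hAQ]
  have hJ1 : ∀ (μ : Fin d) (y : TSite d (towerP L m (n + 1))),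
      ‖B9Eq39Adjoint.J (fun μ => B9Eq33CovDerivVector.shiftEquiv μ) (fun μ y => (fun _ : Bond d (towerP L m (n + 1)) => (1 : 𝔸ˣ)) (y, μ)) η μ y‖ ≤ (0 : ℝ) :=
    fun μ y => norm_J_one_le (𝔸 := 𝔸) η μ y
  exact H n η hηL c₀ c₁ hw hρ m hm (fun _ => 1) (fun _ => 0) (fun _ => le_rfl) hα1 hU1 hreg (fun _ => 0) (fun _ => le_rfl)
    hUε1 hLb1 0 le_rfl hα₁.le
    hUst1 hUb1 hUη1 hpl1 hUgrad1 hRlev1 hεg1 hAQ1 hpos' hpos hposπ hc₀ hJ1 Lw ηw lev₀ lev₁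

set_option maxHeartbeats 400000 in -- margin only, as (J-4): the ≈ 50-binder supplier instantiated at the flat data
include hd hL hL3 hMφ hMφ' hφ hφ' hstar ha ha' hϱ0 hϱ1 hτ hCτ hτm hMτ hρw hτ₁ hτ₂ hφτ hAQ in
/-- **THE (117) SOCKET FOR THE SECOND WORD `H̃_kQ_kG̃_k` AT THE FLAT BACKGROUND** — (J-4) `exists_norm_toCLM115_H1kPiQkG1kPi_le` applied at `U = 1`, `α_j = 0`
(equations `hU`, `hαU`) with `ε_j = α = j₀ = 0`: the thirteen numeric MODEL letters of its block discharged, only the data relations and the subsingleton binders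
`hα1 hαL hU1 hreg hpos′ hpos hposπ hQ` (inhabited, §1) remain.
[cite: Balaban1985Variational, (117) p.295, (110)–(111) p.294; Balaban1985BackgroundPropagators, Thm 3.13 p.426, (3.147) p.425, (3.153) p.426, p.395] -/
theorem exists_norm_toCLM115_H1kPiQkG1kPi_one_le :
    ∃ B : ℝ, 0 ≤ B ∧
      ∀ (n : ℕ) (η : ℝ) (_hηL : η * (L : ℝ) ^ (n + 1) = 1) (c₀ c₁ : ℝ) [Fact (0 < c₀)] [Fact (0 < c₁)]
        (_hw : c₀ * ((L : ℝ) ^ (n + 1)) ^ d = c₁) (_hρ : |η| ^ d / c₀ ≤ ρw) (m : Fin d → ℕ) [∀ i, NeZero (m i)] (_hm : ∀ i, 1 ≤ m i)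
        (U : Bond d (towerP L m (n + 1)) → 𝔸ˣ) (_hU : U = fun _ => 1) (αU : ℕ → ℝ) (_hαU : αU = fun _ => 0) (hα1 : ∀ j, αU j ≤ 1 / 64)
        (hαL : ∀ j, 50 * (d + 1) * αU j * (L : ℝ) ^ d ≤ 1 / 2)
        (hU1 : ∀ (j : ℕ) (x : B7Prop1Explicit.Site d) (k : Fin d), perCfg (towerP L m (j + 1)) (UlevOf L m (n + 1) U j) x k ∈ U1 𝔸)
        (hreg : ∀ (j : ℕ) (y : TSite d (towerP L m j)) (k : Fin d) (ρ' : Fin d → Fin L),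
          ‖((Wcx L (perCfg (towerP L m (j + 1)) (UlevOf L m (n + 1) U j)) (cornerSite L y) k (boxVec L ρ') : 𝔸ˣ) : 𝔸) - 1‖ ≤ αU j)
        (hpos' : ∀ x : SiteL2K ℂ d (towerP L m (n + 1)) c₀ W, x ≠ 0 → 0 < RCLike.re ⟪x, laplacePrimeAk L m n φ η U a' (c₁ := c₁) x⟫_ℂ)
        (_hpos : ∀ x : BondL2K ℂ d (towerP L m (n + 1)) c₀ W, x ≠ 0 →
          0 < RCLike.re ⟪x, laplaceAk L m n φ η U hL αU hα1 hU1 hreg τ (c₀ := c₀) (c₁ := c₁) a x⟫_ℂ)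
        (_hc₀η : c₀ = η ^ d)
        (hposπ : ∀ x : BondL2K ℂ d (towerP L m (n + 1)) c₀ W, x ≠ 0 →
          0 < RCLike.re ⟪x, laplaceAkPi L m n φ τ η U a' hpos' hL αU hα1 hU1 hreg (c₁ := c₁) a x⟫_ℂ)
        (hQ : Function.Surjective (QkW L m n φ U hL αU hα1 hU1 hreg (c₀ := c₀) (c₁ := c₁)))
        (Lw ηw : ℝ) [Fact (0 < Lw)] [Fact (0 < ηw)] (lev₀ : Bond d (towerP L m (n + 1)) → ℕ) (lev₁ : Bond d (towerP L m (n + 1)) × Fin d → ℕ),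
        ‖toCLM115 (L := Lw) (η := ηw) (lev₀ := lev₀) lev₁ (covGrad ((η : ℂ))⁻¹ (adTransportW φ U))
            ((WL2.linearEquiv ℂ ℂ (fun _ : Bond d (towerP L m (n + 1)) => c₀)).toLinearMap ∘ₗ
              ((H1LatticeK hposπ hQ : _ →ₗ[ℂ] _) ∘ₗ
                (QkW L m n φ U hL αU hα1 hU1 hreg (c₀ := c₀) (c₁ := c₁)) ∘ₗ
                (G1LatticeK hposπ : _ →ₗ[ℂ] _)) ∘ₗ
              ((WL2.linearEquiv ℂ ℂ (fun _ : Bond d (towerP L m (n + 1)) => c₀)).symm.toLinearMap :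
                (Bond d (towerP L m (n + 1)) → W) →ₗ[ℂ] BondL2K ℂ d (towerP L m (n + 1)) c₀ W))‖ ≤
          max ((NegSup.wSup (levWeight Lw ηw lev₀ 1) : ℝ) * B) (NegSup.wSup (levWeight Lw ηw lev₁ 2) * B) *
            NegSup.wInvSup (levWeight Lw ηw lev₀ 3) := by
  classical
  obtain ⟨α₁, j₁, B, hα₁, hj₁, hB, H⟩ :=
    exists_norm_toCLM115_H1kPiQkG1kPi_le hd L hL hL3 φ hMφ hMφ' hφ hφ' hstar ha ha' hϱ0 hϱ1 τ hτ hCτ hτm hMτ hρw hτ₁ hτ₂ hφτ AQ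
  refine ⟨B, hB, ?_⟩
  intro n η hηL c₀ c₁ _ _ hw hρ m _ hm U hU αU hαU hα1 hαL hU1 hreg hpos' hpos hc₀η hposπ hQ Lw ηw _ _ lev₀ lev₁
  subst hU hαU
  have hη : 0 < η := eta_pos L hL hηL
  have hUε1 : ∀ (j : ℕ) (b : Bond d (towerP L m (j + 1))), ‖(UlevOf L m (n + 1) (fun _ : Bond d (towerP L m (n + 1)) => (1 : 𝔸ˣ)) j b : 𝔸) - 1‖ ≤ (fun _ : ℕ => (0 : ℝ)) j := by
    intro j b; rw [UlevOf_one]; simp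
  have hLb1 : ∀ (j : ℕ) (b : Bond d (towerP L m (j + 1))), UlevOf L m (n + 1) (fun _ : Bond d (towerP L m (n + 1)) => (1 : 𝔸ˣ)) j b ∈ U1 𝔸 := by
    intro j b; rw [UlevOf_one]; exact Subgroup.one_mem _
  have hUst1 : ∀ b : Bond d (towerP L m (n + 1)), star ((fun _ : Bond d (towerP L m (n + 1)) => (1 : 𝔸ˣ)) b : 𝔸) =
      ((((fun _ : Bond d (towerP L m (n + 1)) => (1 : 𝔸ˣ)) b)⁻¹ : 𝔸ˣ) : 𝔸) := fun b => by simp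
  have hUb1 : ∀ b : Bond d (towerP L m (n + 1)), (fun _ : Bond d (towerP L m (n + 1)) => (1 : 𝔸ˣ)) b ∈ U1 𝔸 := fun b => Subgroup.one_mem _
  have hUη1 : ∀ b : Bond d (towerP L m (n + 1)), ‖((fun _ : Bond d (towerP L m (n + 1)) => (1 : 𝔸ˣ)) b : 𝔸) - 1‖ ≤ 0 * η := fun b => by simp
  have hpl1 : ∀ p : B9SectCLatticeCarrier.Plaq d (towerP L m (n + 1)), ‖(plaqHolU (fun _ : Bond d (towerP L m (n + 1)) => (1 : 𝔸ˣ)) p : 𝔸) - 1‖ ≤ 0 * η ^ 2 :=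
    fun p => by rw [plaqHolU_one]; simp
  have hUgrad1 : ∀ (x : TSite d (towerP L m (n + 1))) (μ : Fin d), ‖((fun _ : Bond d (towerP L m (n + 1)) => (1 : 𝔸ˣ)) (x, μ) : 𝔸) -
      (fun _ : Bond d (towerP L m (n + 1)) => (1 : 𝔸ˣ)) (unshift μ x, μ)‖ ≤ 0 * η ^ 2 := fun x μ => by simp
  have hRlev1 : ∀ (j : ℕ) (b : Bond d (towerP L m (j + 1))) (w : W), ‖adTransportW φ (UlevOf L m (n + 1) (fun _ : Bond d (towerP L m (n + 1)) => (1 : 𝔸ˣ)) j) b w‖ ≤ ‖w‖ := by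
    intro j b w; rw [UlevOf_one, adTransportW_one]; simp
  have hεg1 : ∀ j < n + 1, (fun _ : ℕ => (0 : ℝ)) j ≤ 0 * ϱ ^ j := fun j _ => by simp
  have hAQ1 : ∑ j ∈ Finset.range (n + 1), (fun _ : ℕ => (0 : ℝ)) j ≤ AQ := by simp [hAQ]
  have hJ1 : ∀ (μ : Fin d) (y : TSite d (towerP L m (n + 1))),
      ‖B9Eq39Adjoint.J (fun μ => B9Eq33CovDerivVector.shiftEquiv μ) (fun μ y => (fun _ : Bond d (towerP L m (n + 1)) => (1 : 𝔸ˣ)) (y, μ)) η μ y‖ ≤ (0 : ℝ) :=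
    fun μ y => norm_J_one_le (𝔸 := 𝔸) η μ y
  exact H n η hηL c₀ c₁ hw hρ m hm (fun _ => 1) (fun _ => 0) (fun _ => le_rfl) hα1 hαL hU1 hreg (fun _ => 0) (fun _ => le_rfl)
    hUε1 hLb1 0 le_rfl hα₁.le hUst1 hUb1 hUη1 hpl1 hUgrad1 hRlev1 hεg1 hAQ1 hpos' hpos hc₀η 0 hJ1 hj₁.le hposπ hQ Lw ηw lev₀ lev₁

end Literature.MathematicalPhysics.QuantumFieldTheory.Balaban1983to89.B11Eq117TwoWordsTransformationNormFlat

end
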